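import Summits.QuantumAdvantage.QuantumAdvantage.Theorems.CubicForrelationNearExactIsExactKtThreeStructure
import Summits.QuantumAdvantage.QuantumAdvantage.Theorems.CubicForrelationNearExactIsExactKtGapRestrict
import Summits.QuantumAdvantage.QuantumAdvantage.Theorems.CubicForrelationNearExactIsExactMinWeightFlat
import Summits.QuantumAdvantage.QuantumAdvantage.Theorems.CubicForrelationNearExactIsExactConcatAveraging
import Summits.QuantumAdvantage.QuantumAdvantage.Theorems.CubicForrelationNearExactIsExactTwelveOddWeightR4Cells

/-!
# Crux `CubicForrelation.NearExactIsExact` (stmt-QuantumAdvantage-14043) — Kasami–Tokura for CUBICS, the EXCEPTIONAL word: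
  a cubic with `32·#E = 7·2^m` ones supported in no affine hyperplane is `l₁l₂l₃ ⊕ g` with `lᵢ` affine and `g` a
  minimum-weight cubic (an `(m−3)`-flat), the two pieces meeting in `2^{m−6}` points — i.e. `x₁x₂x₃ ⊕ x₄x₅x₆`

Certificate seat `b2b-cforr-cert` (gen 41).  HONEST FRAMING: a coding-theory brick (standard axioms, no `decide` on data, uniform in `m`),
tool T4 of the Lean roadmap for `E1280-even` (HOME/b2b-cforr-cert-g40/LEAN-PLAN-E1280-EVEN.md §3; HOME/b2b-cforr-cert-g39/E1280-HANDPROOFS.md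
App. A.1 "[Gap for Lean: the structural statement of the exceptional branch]"): the tree's `kt3_structure` (…KtThreeStructure) says a cubic
with `0 < #E < 2^{m−2}` is supported in an affine hyperplane OR has `32·#E = 7·2^m`; this file gives the STRUCTURE in the second case
(Kasami–Tokura 1970, Thm 1, type `x₁x₂x₃ ⊕ x₄x₅x₆`), which the light-cell analysis needs for the descendant `T ⊕ T′`.  Nothing about
`θ₁₂`; NOT summit progress.

THE ARGUMENT (this seat's; the 1970 proof inducts on `f = g ⊕ x_m h`).  Let `w = #E = 7·2^{m−5}`, `E` in no affine hyperplane.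
1. (`kte_cells`) Some derivative `D_a c` has `2^{m−2}` ones (`kt3_exists_rank_two_derivative`), so it is the indicator of a codimension-2
   flat `U = {⟨x,z₁⟩ = b₁, ⟨x,z₂⟩ = b₂}` (`kt3_minweight_quadratic_cells`), `a`-invariant; `E ∩ U` is half of `U` (`x ↦ x ⊕ a` swaps `E ∩ U`
   and `U ∖ E`).  The three "far sides" `E ∩ {⟨x,z₁⟩ ≠ b₁}`, `E ∩ {⟨x,z₂⟩ ≠ b₂}`, `E ∩ {⟨x,z₁⊕z₂⟩ ≠ b₁⊕b₂}` have sizes `s₁ + s₂ + s₃ =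
   2(w − 2^{m−3}) = 3·2^{m−4}`, each is the weight of a cubic on `m − 1` bits (`ktg_restrict`), hence `0`, `2^{m−4}` or `≥ 3·2^{m−5}`
   (`kt3_weights_weak_all`), and non-zero (no hyperplane contains `E`): so `s₁ = s₂ = s₃ = 2^{m−4}` and the three cells of `E` off `U` have
   `2^{m−5}` points each.
2. (`kte_exceptional_structure`) `c·[⟨x,z₁⟩ ≠ b₁]` has degree `≤ 4` and `2^{m−4}` ones: a minimum-weight word of `RM(4,m)`, whose support is a
   flat (`mw_flat_of_minweight`); it meets both sides of `⟨x,z₂⟩`, so it has a period `t₁` with `⟨t₁,z₂⟩ = 1`, `⟨t₁,z₁⟩ = 0`; symmetrically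
   `t₂`.  Put `l := D_{t₁}D_{t₂}c` (affine).  For `y ∈ U` the period relations give `c(y⊕t₁) = c(y⊕t₂) = c(y⊕t₁⊕t₂)`, so
   `c(y) ⊕ l(y) = c(y ⊕ t₁ ⊕ t₂)` with `y ⊕ t₁ ⊕ t₂` in the far cell; hence `g := c ⊕ l·1_U` has `3·2^{m−5} + 2^{m−5} = 2^{m−3}` ones — a
   minimum-weight cubic — and `c = l·[⟨x,z₁⟩ = b₁]·[⟨x,z₂⟩ = b₂] ⊕ g`.  Finally `l` is balanced on `U` (translation by `a` flips it), so
   the cubic `l·1_U` also has `2^{m−3}` ones, and the two supports meet in `2^{m−6}` points.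

References: T. Kasami, N. Tokura, *On the weight structure of Reed–Muller codes*, IEEE Trans. IT 16 (1970) 752–759, Thm 1;
F. J. MacWilliams, N. J. A. Sloane (1977) Ch. 15 §3.  Axioms: the standard three.
-/

set_option linter.dupNamespace false -- D-0017: single-problem summit ⇒ `QuantumAdvantage.QuantumAdvantage` by design

noncomputable section

namespace Summit.QuantumAdvantage.QuantumAdvantage.Theorems.CubicForrelation.NearExactIsExact

open Finset
open Literature.Computability.QuantumComplexity
open Literature.Computability.QuantumComplexity.BuzetChailloux (bxor zeroVec bxor_bxor_cancel_left bxor_zeroVec zeroVec_bxor bxor_comm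
  bxor_self bxor_eq_zeroVec_iff)
open Summit.QuantumAdvantage.QuantumAdvantage.Theorems.SignedCubicForrelationNotPrBPP (knf_isDegLeFun_ip)

/-- Splitting a count by the value of a Boolean function. [folklore] -/
theorem kte_filter_split {m : ℕ} (b : Bool) (Q : (Fin m → Bool) → Bool) (p : (Fin m → Bool) → Prop) [DecidablePred p] :
    #(univ.filter fun x => p x) = #(univ.filter fun x => p x ∧ Q x = b) + #(univ.filter fun x => p x ∧ Q x = !b) := by
  rw [← card_union_of_disjoint]
  · congr 1; ext x; simp only [mem_filter, mem_univ, true_and, mem_union]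
    constructor
    · intro hp; cases hQ : Q x <;> cases b <;> simp [hp]
    · rintro (⟨hp, _⟩ | ⟨hp, _⟩) <;> exact hp
  · rw [disjoint_left]; intro x h h'
    have e1 := (mem_filter.1 h).2.2; have e2 := (mem_filter.1 h').2.2
    rw [e1] at e2; revert e2; cases b <;> decide

/-- **The exceptional word, I: cells.**  For a cubic `c` on `m` bits with `32·#E = 7·2^m` whose support lies in no affine hyperplane there
are a direction `a ≠ 0` and a codimension-2 flat `U = {⟨x,z₁⟩ = b₁, ⟨x,z₂⟩ = b₂}` (`⟨a,zᵢ⟩ = 0`) with `D_a c = 1_U`, `#(E ∩ U) = 2^{m−3}`,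
and `2^{m−5}` points of `E` in each of the three other cells. [this work; cite: KasamiTokura1970, Thm 1] -/
theorem kte_cells {m : ℕ} (c : (Fin m → Bool) → Bool) (hc : IsDegLeFun 3 c)
    (hw : 32 * #(univ.filter fun x => c x = true) = 7 * 2 ^ m)
    (hgen : ¬ ∃ (z : Fin m → Bool) (b : Bool), z ≠ zeroVec ∧
        ∀ x, c x = true → decide (Odd #(univ.filter fun i => (x i && z i) = true)) = b) :
    ∃ (a z₁ z₂ : Fin m → Bool) (b₁ b₂ : Bool), a ≠ zeroVec ∧ z₁ ≠ zeroVec ∧ z₂ ≠ zeroVec ∧ z₁ ≠ z₂ ∧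
      decide (Odd #(univ.filter fun i => (a i && z₁ i) = true)) = false ∧
      decide (Odd #(univ.filter fun i => (a i && z₂ i) = true)) = false ∧
      (∀ x, (c x ^^ c (bxor x a)) = (decide (decide (Odd #(univ.filter fun i => (x i && z₁ i) = true)) = b₁) &&
        decide (decide (Odd #(univ.filter fun i => (x i && z₂ i) = true)) = b₂))) ∧
      8 * #(univ.filter fun x => c x = true ∧ decide (Odd #(univ.filter fun i => (x i && z₁ i) = true)) = b₁ ∧
        decide (Odd #(univ.filter fun i => (x i && z₂ i) = true)) = b₂) = 2 ^ m ∧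
      32 * #(univ.filter fun x => c x = true ∧ decide (Odd #(univ.filter fun i => (x i && z₁ i) = true)) = !b₁ ∧
        decide (Odd #(univ.filter fun i => (x i && z₂ i) = true)) = b₂) = 2 ^ m ∧
      32 * #(univ.filter fun x => c x = true ∧ decide (Odd #(univ.filter fun i => (x i && z₁ i) = true)) = b₁ ∧
        decide (Odd #(univ.filter fun i => (x i && z₂ i) = true)) = !b₂) = 2 ^ m ∧
      32 * #(univ.filter fun x => c x = true ∧ decide (Odd #(univ.filter fun i => (x i && z₁ i) = true)) = !b₁ ∧
        decide (Odd #(univ.filter fun i => (x i && z₂ i) = true)) = !b₂) = 2 ^ m := by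
  classical
  set w := #(univ.filter fun x => c x = true) with hwdef
  have hTpos : 0 < 2 ^ m := by positivity
  have hpos : 0 < w := by
    rcases Nat.eq_zero_or_pos w with h0 | h0
    · rw [h0] at hw; omega
    · exact h0
  have h4 : 4 * w < 2 ^ m := by omega
  -- `m = k + 1`
  obtain ⟨k, rfl⟩ : ∃ k, m = k + 1 := by
    cases m with
    | zero => rw [pow_zero] at hw; omega
    | succ k => exact ⟨k, rfl⟩
  -- 1. a rank-two derivative and its flat
  obtain ⟨a, ha⟩ := kt3_exists_rank_two_derivative c hc hpos h4
  have hQ : IsDegLeFun 2 (fun x => c x ^^ c (bxor x a)) := stub_derivDegree (k + 1) 2 c a hc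
  obtain ⟨z₁, z₂, b₁, b₂, hz₁, hz₂, hz12, hU⟩ := kt3_minweight_quadratic_cells _ hQ ha
  set P₁ : (Fin (k + 1) → Bool) → Bool := fun x => decide (Odd #(univ.filter fun i => (x i && z₁ i) = true)) with hP₁
  set P₂ : (Fin (k + 1) → Bool) → Bool := fun x => decide (Odd #(univ.filter fun i => (x i && z₂ i) = true)) with hP₂
  have hP₁x : ∀ x y, P₁ (bxor x y) = (P₁ x ^^ P₁ y) := fun x y => by rw [hP₁]; exact tow_parity_bxor x y z₁
  have hP₂x : ∀ x y, P₂ (bxor x y) = (P₂ x ^^ P₂ y) := fun x y => by rw [hP₂]; exact tow_parity_bxor x y z₂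
  have hU' : ∀ x, (c x ^^ c (bxor x a)) = true ↔ (P₁ x = b₁ ∧ P₂ x = b₂) := fun x => hU x
  -- the derivative as a product of the two cell indicators
  have hD : ∀ x, (c x ^^ c (bxor x a)) = (decide (P₁ x = b₁) && decide (P₂ x = b₂)) := by
    intro x
    by_cases hx : (c x ^^ c (bxor x a)) = true
    · obtain ⟨h1, h2⟩ := (hU' x).1 hx
      rw [hx, h1, h2]; simp
    · rw [Bool.not_eq_true] at hx
      rw [hx]
      have hn : ¬ (P₁ x = b₁ ∧ P₂ x = b₂) := fun hh => by
        have := (hU' x).2 hh; rw [hx] at this; exact Bool.false_ne_true this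
      symm; rw [Bool.and_eq_false_iff]
      by_cases h1 : P₁ x = b₁
      · right; simpa using fun h2 => hn ⟨h1, h2⟩
      · left; simpa using h1
  -- `a ≠ 0` and `⟨a, zᵢ⟩ = 0`
  have hUcard : 4 * #(univ.filter fun x => P₁ x = b₁ ∧ P₂ x = b₂) = 2 ^ (k + 1) := by
    rw [← ha]; congr 2
    exact filter_congr fun x _ => by rw [hU' x]
  obtain ⟨x₀, hx₀⟩ : (univ.filter fun x => P₁ x = b₁ ∧ P₂ x = b₂).Nonempty := by
    rw [← card_pos]; omega
  obtain ⟨hx₀1, hx₀2⟩ := (mem_filter.1 hx₀).2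
  have hQa : ∀ x, (c (bxor x a) ^^ c (bxor (bxor x a) a)) = (c x ^^ c (bxor x a)) := fun x => by
    rw [iw_bxor_assoc, bxor_self, bxor_zeroVec]; cases c x <;> cases c (bxor x a) <;> rfl
  have hx₀a : P₁ (bxor x₀ a) = b₁ ∧ P₂ (bxor x₀ a) = b₂ := by
    rw [← hU', hQa, hU']; exact ⟨hx₀1, hx₀2⟩
  have ha₁ : P₁ a = false := by
    have e := hx₀a.1; rw [hP₁x, hx₀1] at e; revert e; cases P₁ a <;> cases b₁ <;> decide
  have ha₂ : P₂ a = false := by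
    have e := hx₀a.2; rw [hP₂x, hx₀2] at e; revert e; cases P₂ a <;> cases b₂ <;> decide
  have ha0 : a ≠ zeroVec := by
    intro h0
    have : #(univ.filter fun x => (c x ^^ c (bxor x a)) = true) = 0 := by
      rw [card_eq_zero, filter_eq_empty_iff]
      intro x _; rw [h0, bxor_zeroVec, Bool.xor_self]; exact Bool.false_ne_true
    rw [this] at ha; omega
  -- halving by a translation (as in …CubicFormRadical `tce_half`, inlined to keep this file's imports built)
  have half : ∀ (S : Finset (Fin (k + 1) → Bool)) (t : Fin (k + 1) → Bool) (P : (Fin (k + 1) → Bool) → Bool),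
      (∀ x ∈ S, bxor x t ∈ S) → (∀ x ∈ S, P (bxor x t) = !P x) → 2 * #(S.filter fun x => P x = true) = #S := by
    intro S t P hS hP
    have hcancel : ∀ x : Fin (k + 1) → Bool, bxor (bxor x t) t = x := fun x => by
      rw [iw_bxor_assoc, bxor_self, bxor_zeroVec]
    have himg : (S.filter fun x => P x = false) = (S.filter fun x => P x = true).image (fun x => bxor x t) := by
      ext y
      simp only [mem_filter, mem_image]
      constructor
      · rintro ⟨hyS, hPy⟩
        refine ⟨bxor y t, ⟨hS y hyS, ?_⟩, hcancel y⟩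
        rw [hP y hyS, hPy]; rfl
      · rintro ⟨x, ⟨hxS, hPx⟩, rfl⟩
        refine ⟨hS x hxS, ?_⟩
        rw [hP x hxS, hPx]; rfl
    have hinj : Function.Injective (fun x : Fin (k + 1) → Bool => bxor x t) := fun x y hxy => by
      have e := congrArg (fun z : Fin (k + 1) → Bool => bxor z t) hxy
      simp only [hcancel] at e
      exact e
    have hsplit := card_filter_add_card_filter_not (s := S) (fun x => P x = true)
    have hneg : (S.filter fun x => ¬ P x = true) = (S.filter fun x => P x = false) :=
      filter_congr fun x _ => by cases P x <;> simp
    rw [hneg, himg, card_image_of_injective _ hinj] at hsplit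
    omega
  -- 2. `#(E ∩ U) = 2^{m-3}`
  set e₀ := #(univ.filter fun x => c x = true ∧ P₁ x = b₁ ∧ P₂ x = b₂) with he₀
  have he₀' : 8 * e₀ = 2 ^ (k + 1) := by
    have h := half (univ.filter fun x => P₁ x = b₁ ∧ P₂ x = b₂) a c (fun x hx => ?_) (fun x hx => ?_)
    · have e : ((univ.filter fun x => P₁ x = b₁ ∧ P₂ x = b₂).filter fun x => c x = true) =
          (univ.filter fun x => c x = true ∧ P₁ x = b₁ ∧ P₂ x = b₂) := by
        ext x; simp only [mem_filter, mem_univ, true_and]; tauto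
      rw [e] at h; omega
    · obtain ⟨h1, h2⟩ := (mem_filter.1 hx).2
      refine mem_filter.2 ⟨mem_univ _, ?_, ?_⟩
      · rw [hP₁x, h1, ha₁, Bool.xor_false]
      · rw [hP₂x, h2, ha₂, Bool.xor_false]
    · obtain ⟨h1, h2⟩ := (mem_filter.1 hx).2
      have e := hD x
      rw [h1, h2] at e; simp only [decide_true, Bool.and_self] at e
      revert e; cases c x <;> cases c (bxor x a) <;> decide
  -- 3. the three far sides
  set s₁ := #(univ.filter fun x => c x = true ∧ P₁ x = !b₁) with hs₁
  set s₂ := #(univ.filter fun x => c x = true ∧ P₂ x = !b₂) with hs₂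
  set s₃ := #(univ.filter fun x => c x = true ∧
    decide (Odd #(univ.filter fun i => (x i && (bxor z₁ z₂) i) = true)) = !(b₁ ^^ b₂)) with hs₃
  have hP₃ : ∀ x, decide (Odd #(univ.filter fun i => (x i && (bxor z₁ z₂) i) = true)) = (P₁ x ^^ P₂ x) :=
    fun x => tow_parity_bxor_right x z₁ z₂
  -- each side is the weight of a cubic on `k` bits, at most `w - e₀`
  have hside : ∀ (z : Fin (k + 1) → Bool) (b : Bool), z ≠ zeroVec →
      #(univ.filter fun x => c x = true ∧ decide (Odd #(univ.filter fun i => (x i && z i) = true)) = b) + e₀ ≤ w →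
      #(univ.filter fun x => c x = true ∧ decide (Odd #(univ.filter fun i => (x i && z i) = true)) = b) = 0 ∨
      16 * #(univ.filter fun x => c x = true ∧ decide (Odd #(univ.filter fun i => (x i && z i) = true)) = b) = 2 ^ (k + 1) ∨
      3 * 2 ^ (k + 1) ≤ 32 * #(univ.filter fun x => c x = true ∧ decide (Odd #(univ.filter fun i => (x i && z i) = true)) = b) := by
    intro z b hz hle
    obtain ⟨i₀, hi₀⟩ : ∃ i₀, z i₀ = true := by
      by_contra hno; push Not at hno
      exact hz (funext fun i => by simpa [zeroVec] using hno i)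
    obtain ⟨c', hc', hcard'⟩ := ktg_restrict c hc z i₀ hi₀ b
    rw [← hcard'] at hle ⊢
    have h4' : 4 * #(univ.filter fun y => c' y = true) < 2 ^ k := by
      have : 2 ^ (k + 1) = 2 * 2 ^ k := by rw [pow_succ]; ring
      omega
    rcases kt3_weights_weak_all k c' hc' h4' with h0 | ⟨i, hi, h8⟩
    · exact Or.inl h0
    · right
      have hk1 : 2 ^ (k + 1) = 2 * 2 ^ k := by rw [pow_succ]; ring
      by_cases h8eq : 8 * 2 ^ i = 2 ^ k
      · left; omega
      · right
        have hlt : 2 ^ (i + 3) < 2 ^ k := by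
          have : 2 ^ (i + 3) = 8 * 2 ^ i := by rw [pow_add]; ring
          omega
        have hi3 : i + 4 ≤ k := (Nat.pow_lt_pow_iff_right (by norm_num)).1 hlt
        have h16 : 2 ^ (i + 4) ≤ 2 ^ k := Nat.pow_le_pow_right (by norm_num) hi3
        have : 2 ^ (i + 4) = 16 * 2 ^ i := by rw [pow_add]; ring
        omega
  -- the sides avoid `E ∩ U` and cover `E ∖ U` twice
  have hcount : ∀ x, (if c x = true ∧ P₁ x = !b₁ then 1 else 0) + (if c x = true ∧ P₂ x = !b₂ then 1 else 0) +
      (if c x = true ∧ (P₁ x ^^ P₂ x) = !(b₁ ^^ b₂) then 1 else 0) + 2 * (if c x = true ∧ P₁ x = b₁ ∧ P₂ x = b₂ then 1 else 0) =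
      2 * (if c x = true then 1 else 0) := by
    intro x
    cases c x <;> cases P₁ x <;> cases P₂ x <;> cases b₁ <;> cases b₂ <;> simp
  have hsum : s₁ + s₂ + s₃ + 2 * e₀ = 2 * w := by
    have e3 : s₃ = #(univ.filter fun x => c x = true ∧ (P₁ x ^^ P₂ x) = !(b₁ ^^ b₂)) := by
      rw [hs₃]; congr 1; exact filter_congr fun x _ => by rw [hP₃]
    rw [e3, hs₁, hs₂, he₀, hwdef, card_filter, card_filter, card_filter, card_filter, card_filter, mul_sum, mul_sum,
      ← sum_add_distrib, ← sum_add_distrib, ← sum_add_distrib]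
    exact sum_congr rfl fun x _ => hcount x
  have hs₁le : s₁ + e₀ ≤ w := by
    rw [hs₁, he₀, hwdef, ← card_union_of_disjoint]
    · exact card_le_card fun x hx => by
        rcases mem_union.1 hx with h | h <;> exact mem_filter.2 ⟨mem_univ _, (mem_filter.1 h).2.1⟩
    · rw [disjoint_left]; intro x h h'
      have e1 := (mem_filter.1 h).2.2; have e2 := (mem_filter.1 h').2.2.1
      rw [e2] at e1; revert e1; cases b₁ <;> decide
  have hs₂le : s₂ + e₀ ≤ w := by
    rw [hs₂, he₀, hwdef, ← card_union_of_disjoint]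
    · exact card_le_card fun x hx => by
        rcases mem_union.1 hx with h | h <;> exact mem_filter.2 ⟨mem_univ _, (mem_filter.1 h).2.1⟩
    · rw [disjoint_left]; intro x h h'
      have e1 := (mem_filter.1 h).2.2; have e2 := (mem_filter.1 h').2.2.2
      rw [e2] at e1; revert e1; cases b₂ <;> decide
  have hs₃le : s₃ + e₀ ≤ w := by
    rw [hs₃, he₀, hwdef, ← card_union_of_disjoint]
    · exact card_le_card fun x hx => by
        rcases mem_union.1 hx with h | h <;> exact mem_filter.2 ⟨mem_univ _, (mem_filter.1 h).2.1⟩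
    · rw [disjoint_left]; intro x h h'
      have e1 := (mem_filter.1 h).2.2; obtain ⟨e2, e3⟩ := (mem_filter.1 h').2.2
      rw [hP₃, e2, e3] at e1; revert e1; cases b₁ <;> cases b₂ <;> decide
  have hz3 : bxor z₁ z₂ ≠ zeroVec := fun h => hz12 ((bxor_eq_zeroVec_iff z₁ z₂).1 h)
  have T₁ : s₁ = 0 ∨ 16 * s₁ = 2 ^ (k + 1) ∨ 3 * 2 ^ (k + 1) ≤ 32 * s₁ := hside z₁ (!b₁) hz₁ hs₁le
  have T₂ : s₂ = 0 ∨ 16 * s₂ = 2 ^ (k + 1) ∨ 3 * 2 ^ (k + 1) ≤ 32 * s₂ := hside z₂ (!b₂) hz₂ hs₂le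
  have T₃ : s₃ = 0 ∨ 16 * s₃ = 2 ^ (k + 1) ∨ 3 * 2 ^ (k + 1) ≤ 32 * s₃ := hside (bxor z₁ z₂) (!(b₁ ^^ b₂)) hz3 hs₃le
  -- no side is empty (no hyperplane contains `E`)
  have hne : ∀ (z : Fin (k + 1) → Bool) (b : Bool), z ≠ zeroVec →
      #(univ.filter fun x => c x = true ∧ decide (Odd #(univ.filter fun i => (x i && z i) = true)) = !b) ≠ 0 := by
    intro z b hz h0
    rw [card_eq_zero, filter_eq_empty_iff] at h0
    refine hgen ⟨z, b, hz, fun x hx => ?_⟩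
    have := h0 (mem_univ x)
    revert this hx
    cases c x <;> cases decide (Odd #(univ.filter fun i => (x i && z i) = true)) <;> cases b <;> simp
  have hne₁ := hne z₁ b₁ hz₁
  have hne₂ := hne z₂ b₂ hz₂
  have hne₃ := hne (bxor z₁ z₂) (b₁ ^^ b₂) hz3
  change s₁ ≠ 0 at hne₁
  change s₂ ≠ 0 at hne₂
  change s₃ ≠ 0 at hne₃
  have hS₁ : 16 * s₁ = 2 ^ (k + 1) := by omega
  have hS₂ : 16 * s₂ = 2 ^ (k + 1) := by omega
  have hS₃ : 16 * s₃ = 2 ^ (k + 1) := by omega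
  -- 4. the cells: sides split by the other parity
  set e₁ := #(univ.filter fun x => c x = true ∧ P₁ x = b₁ ∧ P₂ x = !b₂) with he₁
  set e₂ := #(univ.filter fun x => c x = true ∧ P₁ x = !b₁ ∧ P₂ x = b₂) with he₂
  set e₃ := #(univ.filter fun x => c x = true ∧ P₁ x = !b₁ ∧ P₂ x = !b₂) with he₃
  have hs₁split : s₁ = e₂ + e₃ := by
    have eA : (univ.filter fun x => (c x = true ∧ P₁ x = !b₁) ∧ P₂ x = b₂) =
        univ.filter fun x => c x = true ∧ P₁ x = !b₁ ∧ P₂ x = b₂ := filter_congr fun x _ => and_assoc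
    have eB : (univ.filter fun x => (c x = true ∧ P₁ x = !b₁) ∧ P₂ x = !b₂) =
        univ.filter fun x => c x = true ∧ P₁ x = !b₁ ∧ P₂ x = !b₂ := filter_congr fun x _ => and_assoc
    rw [hs₁, he₂, he₃, kte_filter_split b₂ P₂ (fun x => c x = true ∧ P₁ x = !b₁), eA, eB]
  have hs₂split : s₂ = e₁ + e₃ := by
    have eA : (univ.filter fun x => (c x = true ∧ P₂ x = !b₂) ∧ P₁ x = b₁) =
        univ.filter fun x => c x = true ∧ P₁ x = b₁ ∧ P₂ x = !b₂ :=
      filter_congr fun x _ => ⟨fun ⟨⟨h1, h2⟩, h3⟩ => ⟨h1, h3, h2⟩, fun ⟨h1, h2, h3⟩ => ⟨⟨h1, h3⟩, h2⟩⟩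
    have eB : (univ.filter fun x => (c x = true ∧ P₂ x = !b₂) ∧ P₁ x = !b₁) =
        univ.filter fun x => c x = true ∧ P₁ x = !b₁ ∧ P₂ x = !b₂ :=
      filter_congr fun x _ => ⟨fun ⟨⟨h1, h2⟩, h3⟩ => ⟨h1, h3, h2⟩, fun ⟨h1, h2, h3⟩ => ⟨⟨h1, h3⟩, h2⟩⟩
    rw [hs₂, he₁, he₃, kte_filter_split b₁ P₁ (fun x => c x = true ∧ P₂ x = !b₂), eA, eB]
  have hs₃split : s₃ = e₁ + e₂ := by
    have e3 : s₃ = #(univ.filter fun x => c x = true ∧ (P₁ x ^^ P₂ x) = !(b₁ ^^ b₂)) := by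
      rw [hs₃]; congr 1; exact filter_congr fun x _ => by rw [hP₃]
    have key : ∀ (u v : Bool), ((u ^^ v) = !(b₁ ^^ b₂) ∧ u = b₁ ↔ u = b₁ ∧ v = !b₂) ∧
        ((u ^^ v) = !(b₁ ^^ b₂) ∧ u = !b₁ ↔ u = !b₁ ∧ v = b₂) := by
      intro u v; cases u <;> cases v <;> cases b₁ <;> cases b₂ <;> decide
    have eA : (univ.filter fun x => (c x = true ∧ (P₁ x ^^ P₂ x) = !(b₁ ^^ b₂)) ∧ P₁ x = b₁) =
        univ.filter fun x => c x = true ∧ P₁ x = b₁ ∧ P₂ x = !b₂ :=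
      filter_congr fun x _ => by rw [and_assoc, (key (P₁ x) (P₂ x)).1]
    have eB : (univ.filter fun x => (c x = true ∧ (P₁ x ^^ P₂ x) = !(b₁ ^^ b₂)) ∧ P₁ x = !b₁) =
        univ.filter fun x => c x = true ∧ P₁ x = !b₁ ∧ P₂ x = b₂ :=
      filter_congr fun x _ => by rw [and_assoc, (key (P₁ x) (P₂ x)).2]
    rw [e3, he₁, he₂, kte_filter_split b₁ P₁ (fun x => c x = true ∧ (P₁ x ^^ P₂ x) = !(b₁ ^^ b₂)), eA, eB]
  refine ⟨a, z₁, z₂, b₁, b₂, ha0, hz₁, hz₂, hz12, ha₁, ha₂, hD, he₀', ?_, ?_, ?_⟩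
  · change 32 * e₂ = 2 ^ (k + 1); omega
  · change 32 * e₁ = 2 ^ (k + 1); omega
  · change 32 * e₃ = 2 ^ (k + 1); omega

end Summit.QuantumAdvantage.QuantumAdvantage.Theorems.CubicForrelation.NearExactIsExact

end
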